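import Summits.HubbardSuperconductivity.HubbardSuperconductivity.Theses.ThermalWedge
import Summits.HubbardSuperconductivity.HubbardSuperconductivity.Theorems.ThermalWedgeTwSeededRungThermalWindow

/-!
# Route `ThermalWedge` — glue item `TwThermalWindowRungGlue` (stmt-HubbardSuperconductivity-15417)

`TwSeededEnsembleEquivalenceR → TwSourcedCondensation → ⟨body of TwSeededRung⟩`.

This is the landed, route-file-free structural engine
`Summit.HubbardSuperconductivity.HubbardSuperconductivity.Theorems.twSeededRung_structural_thermalWindow`
(`Theorems/ThermalWedgeTwSeededRungThermalWindow.lean`), whose two hypotheses and conclusion are the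
verbatim bodies of the three route decls, restated as an implication between the route decls.
The proof is the definitional application of the engine.
-/

set_option linter.dupNamespace false

namespace Summit.HubbardSuperconductivity.HubbardSuperconductivity.Theorems

open Summit.HubbardSuperconductivity.HubbardSuperconductivity.Theses.ThermalWedge

/-- **Glue `TwThermalWindowRungGlue`** (stmt-HubbardSuperconductivity-15417): the thermal-window
ensemble equivalence `TwSeededEnsembleEquivalenceR` and the sourced condensation
`TwSourcedCondensation` give the anchor `TwSeededRung` (body inlined in the glue decl), by the
structural engine `twSeededRung_structural_thermalWindow`. -/
theorem twThermalWindowRungGlue_proof : TwThermalWindowRungGlue := by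
  unfold TwThermalWindowRungGlue
  intro hE hC
  exact twSeededRung_structural_thermalWindow hE hC

end Summit.HubbardSuperconductivity.HubbardSuperconductivity.Theorems
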